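import Summits.CriticalPhenomena.SAWScalingLimit.Theorems.SAWLeftRightFKGLeftRightFKGStubLoopWindVanish
import Summits.CriticalPhenomena.SAWScalingLimit.Theorems.SAWLeftRightFKGLeftRightFKGStubStepMonotoneAux2
import Literature.Probability.RandomPlanarGeometry.PolygonalDomains
import Literature.Topology.PlaneTopology.JordanSweepParity
import HarnessLib

/-!
# Stub `stub_lensDichotomy` of line `corner-localisation`, helper file: lattice cycles are
Jordan polygons

Crux `LeftRightFKG` (stmt-CriticalPhenomena-11232), vocabulary module
`Summits.CriticalPhenomena.SAWScalingLimit.Theorems.SAWLeftRightFKGLeftRightFKGDefs`.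

* **Jordan curve theorem for cycles of a lattice subgraph `G ≤ ℤ²`.** The vertex list
  `pt L(0), …, pt L(n-1)` of a cycle `L` spans a simple closed polygon
  (`isSimpleClosedPolygon_of_isCycle`: two unit lattice edges at a common vertex in different
  directions meet only there, non-adjacent edges of the cycle have four distinct endpoints), whose
  closed polygon `polygonLoop` has the trace of the polyline of `L` (`range_polygonLoop_eq`); by
  the tree's Jordan curve theorem (`IsJordanLoop.inside_eq_connectedComponentIn`) the winding
  number of that polyline takes only the values `0` (outside, and junk on the trace) and one
  constant `w₀` (inside): `exists_wind_eq_of_isCycle` = registered sub-goal `stub_lensDichotomyAux`.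
* Crossing-count bookkeeping (`wcross`) of prefixes, middles and suffixes of walks: the lens count
  of two walks with a common prefix and suffix is that of their middles
  (`wcross_sub_wcross_eq_middles`).
-/

noncomputable section

open Set Complex Literature.Probability.LatticeModels Literature.Probability.RandomPlanarGeometry
open Literature.Topology.PlaneTopology
open Summit.CriticalPhenomena.SAWScalingLimit.Theorems.LeftRightFKG.Negative

namespace Summit.CriticalPhenomena.SAWScalingLimit.Theorems.LeftRightFKG.CornerLoc

namespace LensDichotomy

variable {G : SimpleGraph (Site 2)}

/-! ## Unit lattice segments at a common endpoint -/

/-- **Two unit lattice segments from the same site in different directions meet only at that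
site.** (A common point other than the far endpoints has a coordinate strictly between two
consecutive integers, which forces both segments to be the unit segment through it.)
[folklore] -/
theorem eq_pt_of_mem_segment_of_mem_segment {p x y : Site 2} (hx : (zdGraph 2).Adj p x)
    (hy : (zdGraph 2).Adj p y) (hxy : x ≠ y) {z : ℂ} (h1 : z ∈ segment ℝ (pt p) (pt x))
    (h2 : z ∈ segment ℝ (pt p) (pt y)) : z = pt p := by
  by_contra hzp
  have key : ∀ {x y : Site 2}, (zdGraph 2).Adj p x → (zdGraph 2).Adj p y →
      z ∈ segment ℝ (pt p) (pt x) → z ∈ segment ℝ (pt p) (pt y) → z ≠ pt x → x = y := by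
    intro x y hx hy h1 h2 hzx
    rcases exists_strict_of_mem_segment hx h1 hzp hzx with ⟨m, hm, hm'⟩ | ⟨k, hk, hk'⟩
    · obtain ⟨hx1, -, hx0⟩ := horiz_of_mem_segment hx h1 hm hm'
      obtain ⟨hy1, -, hy0⟩ := horiz_of_mem_segment hy h2 hm hm'
      have h0 : x 0 = y 0 := by
        rcases hx0 with ⟨ha, hb⟩ | ⟨ha, hb⟩ <;> rcases hy0 with ⟨hc, hd⟩ | ⟨hc, hd⟩ <;> omega
      rw [eq_bx x, eq_bx y, h0, hx1, hy1]
    · obtain ⟨hx0, -, hx1⟩ := vert_of_mem_segment hx h1 hk hk'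
      obtain ⟨hy0, -, hy1⟩ := vert_of_mem_segment hy h2 hk hk'
      have h1' : x 1 = y 1 := by
        rcases hx1 with ⟨ha, hb⟩ | ⟨ha, hb⟩ <;> rcases hy1 with ⟨hc, hd⟩ | ⟨hc, hd⟩ <;> omega
      rw [eq_bx x, eq_bx y, h1', hx0, hy0]
  by_cases hzx : z = pt x
  · by_cases hzy : z = pt y
    · exact hxy (StepMono.pt_inj (hzx.symm.trans hzy))
    · exact hxy (key hy hx h2 h1 hzy).symm
  · exact hxy (key hx hy h1 h2 hzx)

/-! ## The polyline of a walk is the union of its unit edges -/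

/-- The polyline of a non-trivial walk of a graph on `ℤ²` is the union of the closed segments
between its consecutive vertices. [folklore] -/
theorem range_poly_walk : ∀ {u v : Site 2} (w : G.Walk u v), 0 < w.length →
    range (poly u w.support.tail) =
      ⋃ i < w.length, segment ℝ (pt (w.getVert i)) (pt (w.getVert (i + 1)))
  | _, _, SimpleGraph.Walk.nil, h => by simp at h
  | u, _, SimpleGraph.Walk.cons (v := v) h SimpleGraph.Walk.nil, _ => by
    have h1 : range (poly v ([] : List (Site 2))) = {pt v} := by
      change range (Path.refl (pt v)) = _
      exact Path.refl_range
    change range (poly u [v]) = _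
    rw [range_poly_cons, h1, SimpleGraph.Walk.length_cons, SimpleGraph.Walk.length_nil,
      zero_add, Set.biUnion_lt_succ']
    simp only [Nat.not_lt_zero, Set.iUnion_false, Set.iUnion_empty, Set.union_empty,
      SimpleGraph.Walk.getVert_zero, SimpleGraph.Walk.getVert_cons_succ]
    exact Set.union_eq_self_of_subset_right (singleton_subset_iff.2 (right_mem_segment _ _ _))
  | u, _, SimpleGraph.Walk.cons (v := v) h (SimpleGraph.Walk.cons h' p), _ => by
    have ih : range (poly v (SimpleGraph.Walk.cons h' p).support.tail) = _ :=
      range_poly_walk (SimpleGraph.Walk.cons h' p) (by simp)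
    change range (poly u (v :: (SimpleGraph.Walk.cons h' p).support.tail)) = _
    rw [range_poly_cons, ih]
    conv_rhs => rw [SimpleGraph.Walk.length_cons, Set.biUnion_lt_succ']
    simp only [SimpleGraph.Walk.getVert_zero, SimpleGraph.Walk.getVert_cons_succ, zero_add]

/-! ## Lattice cycles are simple closed polygons -/

/-- Cyclic indexing of the vertices of a closed walk: `L((i + 1) mod n) = L(i + 1)` for
`i < n`. [folklore] -/
theorem getVert_succ_mod {u : Site 2} (L : G.Walk u u) {i : ℕ} (hi : i < L.length) :
    L.getVert ((i + 1) % L.length) = L.getVert (i + 1) := by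
  rcases Nat.lt_or_ge (i + 1) L.length with h | h
  · rw [Nat.mod_eq_of_lt h]
  · rw [show i + 1 = L.length by omega, Nat.mod_self, SimpleGraph.Walk.getVert_zero,
      SimpleGraph.Walk.getVert_length]

/-- The `i`-th vertex of the vertex list of a closed walk. [folklore] -/
theorem vertexList_getElem {u : Site 2} (L : G.Walk u u) {i : ℕ}
    (hi : i < ((List.range L.length).map fun i => pt (L.getVert i)).length) :
    ((List.range L.length).map fun i => pt (L.getVert i))[i] = pt (L.getVert i) := by
  simp

/-- The cyclically next vertex of the vertex list of a closed walk. [folklore] -/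
theorem vertexList_getElem_succ {u : Site 2} (L : G.Walk u u) {i : ℕ}
    (hi : i < ((List.range L.length).map fun i => pt (L.getVert i)).length) :
    ((List.range L.length).map fun i => pt (L.getVert i))[(i + 1) %
        ((List.range L.length).map fun i => pt (L.getVert i)).length]'(Nat.mod_lt _ (by omega)) =
      pt (L.getVert (i + 1)) := by
  simp only [List.getElem_map, List.getElem_range, List.length_map, List.length_range]
  rw [getVert_succ_mod L (by simpa using hi)]

/-- The vertices of a cycle are distinct up to the identification of the positions `0` and
`n`. [folklore] -/
theorem eq_of_getVert_eq {u : Site 2} {L : G.Walk u u} (hL : L.IsCycle) {i j : ℕ}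
    (hi : i ≤ L.length) (hj : j ≤ L.length) (h : L.getVert i = L.getVert j) :
    i = j ∨ i + L.length = j ∨ j + L.length = i := by
  rcases Nat.lt_or_ge i L.length with hi' | hi' <;> rcases Nat.lt_or_ge j L.length with hj' | hj'
  · exact Or.inl (hL.getVert_injOn' (by simp only [Set.mem_setOf_eq]; omega)
      (by simp only [Set.mem_setOf_eq]; omega) h)
  · rcases Nat.eq_zero_or_pos i with rfl | hi0
    · exact Or.inr (Or.inl (by omega))
    · have := hL.getVert_injOn (by simp only [Set.mem_setOf_eq]; omega)
        (by simp only [Set.mem_setOf_eq]; omega) h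
      omega
  · rcases Nat.eq_zero_or_pos j with rfl | hj0
    · exact Or.inr (Or.inr (by omega))
    · have := hL.getVert_injOn (by simp only [Set.mem_setOf_eq]; omega)
        (by simp only [Set.mem_setOf_eq]; omega) h
      omega
  · exact Or.inl (by omega)

/-- **A cycle of a lattice subgraph spans a simple closed polygon**: the list
`pt L(0), …, pt L(n-1)` satisfies `IsSimpleClosedPolygon` — consecutive vertices are lattice
neighbours (hence distinct), adjacent unit edges meet only at their common vertex, which the
half-open edges attribute to exactly one of them, and non-adjacent edges have four distinct
endpoints, hence are disjoint unit lattice segments. [folklore] -/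
theorem isSimpleClosedPolygon_of_isCycle (hG : ∀ x y, G.Adj x y → (zdGraph 2).Adj x y)
    {u : Site 2} {L : G.Walk u u} (hL : L.IsCycle) :
    IsSimpleClosedPolygon ((List.range L.length).map fun i => pt (L.getVert i)) := by
  have h3 : 3 ≤ L.length := hL.three_le_length
  have hlen : ((List.range L.length).map fun i => pt (L.getVert i)).length = L.length := by simp
  have hadj : ∀ i < L.length, (zdGraph 2).Adj (L.getVert i) (L.getVert (i + 1)) :=
    fun i hi => hG _ _ (L.adj_getVert_succ hi)
  have hne : ∀ i < L.length, pt (L.getVert i) ≠ pt (L.getVert (i + 1)) :=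
    fun i hi h => (hadj i hi).ne (StepMono.pt_inj h)
  have hL0 : L.getVert L.length = L.getVert 0 := by
    rw [SimpleGraph.Walk.getVert_length, SimpleGraph.Walk.getVert_zero]
  -- the far endpoint of a nondegenerate half-open segment is not on it
  have hright : ∀ {x y : ℂ}, x ≠ y → y ∉ icoSegment x y := fun hxy ⟨θ, hθ, he⟩ =>
    (AffineMap.lineMap_eq_right_iff.1 he).elim hxy hθ.2.ne
  refine IsSimpleClosedPolygon.of_lt (by omega) (fun i hi => ?_) (fun i j hi hj hij => ?_)
  · rw [vertexList_getElem L hi, vertexList_getElem_succ L hi]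
    exact hne i (by omega)
  rw [vertexList_getElem L hi, vertexList_getElem_succ L hi, vertexList_getElem L hj,
    vertexList_getElem_succ L hj, Set.disjoint_left]
  intro z hz hz'
  have hi' : i < L.length := by omega
  have hj' : j < L.length := by omega
  have hzs := icoSegment_subset_segment _ _ hz
  have hzs' := icoSegment_subset_segment _ _ hz'
  by_cases hA : j = i + 1
  · -- adjacent edges at the vertex `L(i+1)`
    subst hA
    have hxy : L.getVert i ≠ L.getVert (i + 1 + 1) := fun h => by
      rcases eq_of_getVert_eq hL (by omega) (by omega) h with h | h | h <;> omega
    have key := eq_pt_of_mem_segment_of_mem_segment (hadj i hi').symm (hadj (i + 1) hj') hxy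
      (by rw [segment_symm]; exact hzs) hzs'
    rw [key] at hz
    exact hright (hne i hi') hz
  by_cases hB : i = 0 ∧ j + 1 = L.length
  · -- adjacent edges at the vertex `L(0) = L(n)`
    obtain ⟨rfl, hjn⟩ := hB
    have hj0 : L.getVert (j + 1) = L.getVert 0 := by rw [hjn, hL0]
    have hxy : L.getVert (0 + 1) ≠ L.getVert j := fun h => by
      rcases eq_of_getVert_eq hL (by omega) (by omega) h with h | h | h <;> omega
    have hadj' : (zdGraph 2).Adj (L.getVert 0) (L.getVert j) := by
      rw [← hj0]; exact (hadj j hj').symm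
    have key := eq_pt_of_mem_segment_of_mem_segment (hadj 0 hi') hadj' hxy hzs
      (by rw [segment_symm, ← hj0]; exact hzs')
    rw [key, ← hj0] at hz'
    exact hright (hne j hj') hz'
  -- non-adjacent edges: four distinct endpoints
  have hdist : ∀ a, (a = i ∨ a = i + 1) → ∀ b, (b = j ∨ b = j + 1) → L.getVert a ≠ L.getVert b := by
    intro a ha b hb h
    rcases eq_of_getVert_eq hL (by omega) (by omega) h with h | h | h <;> omega
  have hoff : ∀ a, (a = i ∨ a = i + 1) →
      pt (L.getVert a) ∉ segment ℝ (pt (L.getVert j)) (pt (L.getVert (j + 1))) := by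
    intro a ha h
    rcases pt_eq_of_mem_segment (hadj j hj') h with h | h
    · exact hdist a ha j (Or.inl rfl) (StepMono.pt_inj h)
    · exact hdist a ha (j + 1) (Or.inr rfl) (StepMono.pt_inj h)
  exact Set.disjoint_left.1 (disjoint_segment_of_not_mem (hadj i hi') (hadj j hj')
    (hoff i (Or.inl rfl)) (hoff (i + 1) (Or.inr rfl))) hzs hzs'

/-- The closed polygon through the vertex list of a lattice cycle has the same trace as the
polyline of the cycle (both are the union of the closed unit edges). [folklore] -/
theorem range_polygonLoop_eq {u : Site 2} {L : G.Walk u u} (hL : L.IsCycle) :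
    range (polygonLoop ((List.range L.length).map fun i => pt (L.getVert i))) =
      range (poly u L.support.tail) := by
  have h3 : 3 ≤ L.length := hL.three_le_length
  have hlen : ((List.range L.length).map fun i => pt (L.getVert i)).length = L.length := by simp
  have hne : ((List.range L.length).map fun i => pt (L.getVert i)) ≠ [] := fun h => by
    rw [h, List.length_nil] at hlen; omega
  rw [range_polygonLoop hne, range_poly_walk L (by omega)]
  ext z
  simp only [Set.mem_iUnion, exists_prop]
  constructor
  · rintro ⟨k, hz⟩
    rw [vertexList_getElem L k.2, vertexList_getElem_succ L k.2] at hz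
    exact ⟨k, by have := k.2; omega, hz⟩
  · rintro ⟨i, hi, hz⟩
    have hi' : i < ((List.range L.length).map fun i => pt (L.getVert i)).length := by omega
    exact ⟨⟨i, hi'⟩, by rw [vertexList_getElem L hi', vertexList_getElem_succ L hi']; exact hz⟩

/-! ## Crossing counts of pieces of walks -/

/-- `wcross` only depends on the support of the walk. [folklore] -/
theorem wcross_congr (M K : ℤ) {u v u' v' : Site 2} (w : G.Walk u v) (w' : G.Walk u' v')
    (h : w.support = w'.support) : wcross M K w = wcross M K w' := by
  rw [← w.cons_tail_support, ← w'.cons_tail_support] at h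
  obtain ⟨rfl, h2⟩ := List.cons.inj h
  unfold wcross
  rw [h2]

/-- `wcross` is invariant under `Walk.copy`. [folklore] -/
theorem wcross_copy (M K : ℤ) {u v u' v' : Site 2} (w : G.Walk u v) (hu : u = u') (hv : v = v') :
    wcross M K (w.copy hu hv) = wcross M K w := by
  subst hu hv
  rfl

/-- Two walks from `a` agreeing on positions `≤ k` (both of length `≥ k`) have the same first
`k` steps. [folklore] -/
theorem support_take_eq {a b b' : Site 2} {w₁ : G.Walk a b} {w₂ : G.Walk a b'} {k : ℕ}
    (hk : ∀ i ≤ k, w₁.getVert i = w₂.getVert i) (h₁ : k ≤ w₁.length) (h₂ : k ≤ w₂.length) :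
    (w₁.take k).support = (w₂.take k).support := by
  rw [SimpleGraph.Walk.support_take, SimpleGraph.Walk.support_take]
  apply List.ext_getElem
  · simp only [List.length_take, SimpleGraph.Walk.length_support]
    omega
  · intro i hi hi'
    rw [List.getElem_take, List.getElem_take, SimpleGraph.Walk.support_getElem_eq_getVert,
      SimpleGraph.Walk.support_getElem_eq_getVert]
    exact hk i (by simp only [List.length_take] at hi; omega)

/-- The last `m + 1` vertices of a walk are the first `m + 1` vertices of its reversal,
reversed. [folklore] -/
theorem support_drop_eq_reverse {a b : Site 2} (w : G.Walk a b) (m : ℕ) :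
    (w.drop (w.length - m)).support = (w.reverse.take m).support.reverse := by
  rw [SimpleGraph.Walk.drop_support_eq_support_drop_min, min_eq_left (Nat.sub_le _ _),
    SimpleGraph.Walk.support_take, SimpleGraph.Walk.support_reverse, List.take_reverse,
    List.reverse_reverse, SimpleGraph.Walk.length_support]
  congr 1
  omega

/-- The crossing count of a walk splits over a prefix, a middle and a suffix. [folklore] -/
theorem wcross_split (M K : ℤ) {a b : Site 2} (w : G.Walk a b) (i j : ℕ) :
    wcross M K w = wcross M K (w.take i) + wcross M K ((w.drop i).take j) +
      wcross M K ((w.drop i).drop j) := by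
  have h1 := wcross_append M K (w.take i) (w.drop i)
  have h2 := wcross_append M K ((w.drop i).take j) ((w.drop i).drop j)
  rw [SimpleGraph.Walk.append_take_drop_eq] at h1 h2
  rw [h1, h2, add_assoc]

/-- **Prefix/suffix cancellation.** For two walks `w₁`, `w₂` from `a` to `b` sharing their first
`k + 1` and their last `m + 1` vertices (`k + m ≤` both lengths), the difference of the crossing
counts (the lens count) equals that of the MIDDLES `wᵢ[k, |wᵢ| - m]`. [folklore] -/
theorem wcross_sub_wcross_eq_middles (M K : ℤ) {a b : Site 2} (w₁ w₂ : G.Walk a b) {k m : ℕ}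
    (hk : ∀ i ≤ k, w₁.getVert i = w₂.getVert i)
    (hm : ∀ j ≤ m, w₁.reverse.getVert j = w₂.reverse.getVert j)
    (h₁ : k + m ≤ w₁.length) (h₂ : k + m ≤ w₂.length) :
    wcross M K w₁ - wcross M K w₂ =
      wcross M K ((w₁.drop k).take (w₁.length - m - k)) -
        wcross M K ((w₂.drop k).take (w₂.length - m - k)) := by
  -- prefixes
  have hp : wcross M K (w₁.take k) = wcross M K (w₂.take k) :=
    wcross_congr M K _ _ (support_take_eq hk (by omega) (by omega))
  -- suffixes
  have hs : ∀ (w : G.Walk a b), k + m ≤ w.length →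
      wcross M K ((w.drop k).drop (w.length - m - k)) = wcross M K (w.drop (w.length - m)) := by
    intro w hw
    apply wcross_congr
    simp only [SimpleGraph.Walk.drop_support_eq_support_drop_min, SimpleGraph.Walk.drop_length,
      List.drop_drop]
    rw [min_eq_left (by omega : k ≤ w.length),
      min_eq_left (by omega : w.length - m - k ≤ w.length - k),
      min_eq_left (by omega : w.length - m ≤ w.length)]
    congr 1
    omega
  have hs' : wcross M K (w₁.drop (w₁.length - m)) = wcross M K (w₂.drop (w₂.length - m)) := by
    apply wcross_congr
    rw [support_drop_eq_reverse, support_drop_eq_reverse,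
      support_take_eq (w₁ := w₁.reverse) (w₂ := w₂.reverse) hm (by simp; omega) (by simp; omega)]
  rw [wcross_split M K w₁ k (w₁.length - m - k), wcross_split M K w₂ k (w₂.length - m - k), hp,
    hs w₁ h₁, hs w₂ h₂, hs']
  ring

/-! ## The winding number of a lattice cycle takes two values -/

/-- **JORDAN FOR LATTICE CYCLES.** For a cycle `L` of a lattice subgraph `G ≤ ℤ²` there is an
integer `w₀` such that the winding number of the polyline of `L` (the crux's `Set.IccExtend` of
`toCurve` at mesh `1`) about every point of the plane is `0` or `w₀`: it is the junk value `0` on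
the trace, `0` on the unbounded complementary component and constant on the bounded one, and by
the Jordan curve theorem (`IsJordanLoop.inside_eq_connectedComponentIn`, applied to the simple
closed polygon `polygonLoop` with the same trace) there are no other components.
[folklore] -/
theorem exists_wind_eq_of_isCycle (hG : ∀ x y, G.Adj x y → (zdGraph 2).Adj x y) {u : Site 2}
    {L : G.Walk u u} (hL : L.IsCycle) :
    ∃ w₀ : ℤ, ∀ z : ℂ,
      wind (fun t : ℝ => IccExtend zero_le_one (L.toCurve (meshPoint 1)) t - z) = 0 ∨
        wind (fun t : ℝ => IccExtend zero_le_one (L.toCurve (meshPoint 1)) t - z) = w₀ := by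
  simp only [iccExtend_toCurve_apply]
  set P := poly u L.support.tail with hP
  set l := (List.range L.length).map fun i => pt (L.getVert i) with hl
  have hJ : IsJordanLoop (polygonLoop l) :=
    ⟨continuous_polygonLoop l, periodic_polygonLoop l,
      injOn_polygonLoop (isSimpleClosedPolygon_of_isCycle hG hL)⟩
  have hK : range (polygonLoop l) = range P := range_polygonLoop_eq hL
  have h01 : P.extend 0 = P.extend 1 := by
    rw [Path.extend_zero, Path.extend_one, poly_fst_walk L]
  have hKc : IsClosed (range P) := (isCompact_range P.continuous).isClosed
  have hmaps : MapsTo P.extend (Icc 0 1) (range P) := fun t ht => by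
    rw [Path.extend_apply P ht]; exact ⟨_, rfl⟩
  have himg : P.extend '' Icc 0 1 = range P := Path.image_extend_of_subset P Subset.rfl
  -- outside: winding number `0`
  have hout : ∀ z ∈ IsJordanLoop.outside (polygonLoop l),
      wind (fun t => P.extend t - z) = 0 := by
    intro z hz
    refine wind_sub_eq_zero_of_not_isBounded P.continuous_extend.continuousOn h01 fun hb => ?_
    rw [himg, ← hK] at hb
    exact hz.2 hb
  by_cases hin : (IsJordanLoop.inside (polygonLoop l)).Nonempty
  · obtain ⟨z₀, hz₀⟩ := hin
    refine ⟨wind (fun t => P.extend t - z₀), fun z => ?_⟩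
    by_cases hz : z ∈ range P
    · exact Or.inl (wind_eq_zero_of_mem_range P hz)
    rw [← hK] at hz
    rcases IsJordanLoop.mem_inside_or_mem_outside hz with hzi | hzo
    · right
      rw [hJ.inside_eq_connectedComponentIn hz₀, hK] at hzi
      exact (wind_sub_eq_of_mem_connectedComponentIn P.continuous_extend.continuousOn h01 hKc
        hmaps hzi).symm
    · exact Or.inl (hout z hzo)
  · refine ⟨0, fun z => Or.inl ?_⟩
    by_cases hz : z ∈ range P
    · exact wind_eq_zero_of_mem_range P hz
    rw [← hK] at hz
    rcases IsJordanLoop.mem_inside_or_mem_outside hz with hzi | hzo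
    · exact absurd ⟨z, hzi⟩ hin
    · exact hout z hzo

end LensDichotomy

/-- REGISTERED SUB-GOAL `stub_lensDichotomyAux` of stub `stub_lensDichotomy` (this helper file's
main theorem, recorded on the crux item so that the file lands as a `--supports` proof): JORDAN FOR
LATTICE CYCLES — the winding number of the polyline of a cycle of a lattice subgraph `G ≤ ℤ²`
about the points of the plane takes at most the two values `0` and `w₀`.
[folklore] -/
theorem stub_lensDichotomyAux : ∀ (G : SimpleGraph (Site 2)),
    (∀ x y, G.Adj x y → (zdGraph 2).Adj x y) → ∀ (u : Site 2) (L : G.Walk u u), L.IsCycle →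
    ∃ w₀ : ℤ, ∀ z : ℂ,
      wind (fun t : ℝ => Set.IccExtend zero_le_one (L.toCurve (meshPoint 1)) t - z) = 0 ∨
        wind (fun t : ℝ => Set.IccExtend zero_le_one (L.toCurve (meshPoint 1)) t - z) = w₀ :=
  fun _ hG _ _ hL => LensDichotomy.exists_wind_eq_of_isCycle hG hL

end Summit.CriticalPhenomena.SAWScalingLimit.Theorems.LeftRightFKG.CornerLoc

end
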